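import Literature.NumberTheory.EllipticCurves.CMSigmaSqIntegralityProofs
import Literature.NumberTheory.EllipticCurves.FormalGroupFrobeniusTypeAllPrimesProofs
import HarnessLib

/-!
# The `ℤ_p`-module structure `[c] = exp_W(c·log_W)` of the formal group of a Weierstrass curve:
# endomorphisms, sums, composites, reduction modulo `p` (Silverman AEC IV.2–IV.5; proofs only)

Topic `NumberTheory/EllipticCurves` (theorems only; no definition, no named fact, no instance).
For a Weierstrass curve `W/ℚ_p` write `[c] := exp_W(c·log_W) ∈ ℚ_p⟦z⟧` (`c ∈ ℚ_p`), spelled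
`W.formalExp.subst (C c * W.formalLog)` throughout (as in `CMSigmaSqIntegralityProofs`, whose §A proves
`log_W([c]) = c·log_W` and, on a `p`-integral model, `[c] ∈ ℤ_p⟦z⟧` for `c ∈ ℤ_p`).  Over the `ℚ`-algebra
`ℚ_p` the formal group law is `F(z₁, z₂) = exp_W(log_W z₁ + log_W z₂)`
(`formalGroupLaw_eq_formalExp_subst`), so:

* §1 `formalExp_subst_C_mul_formalLog_subst_formalGroupLaw` — **`[c] ∈ End(Ŵ)`**: `[c](F(z₁,z₂)) =
  F([c]z₁, [c]z₂)`; `formalGroupLaw_subst_pair_formalExp_subst_C_mul_formalLog` — **`F([c], [d]) = [c + d]`**;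
  `formalExp_subst_C_mul_formalLog_subst_formalExp_subst_C_mul_formalLog` — **`[c] ∘ [d] = [cd]`**;
  `formalExp_subst_natCast_mul_formalLog` — `[n] = formalMul n`; `formalNeg_subst_formalMul_eq` —
  `i ∘ [n] = [−n]`; `coeff_one_formalExp_subst_C_mul_formalLog` — `[c] = cz + O(z²)`;
  `coeff_one_formalGroupLaw_subst_X_pow_formalNeg` — `F(zᵖ, i([c] z)) = −c z + O(z²)` (`p ≥ 2`).
* §2 (a Weierstrass equation `V/ℤ_p`, `W = V ⊗ ℚ_p`, `c ∈ ℤ_p`): the same identities for the INTEGRAL series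
  `[c]_ℤ := toPadicInt [c] ∈ ℤ_p⟦z⟧` (transfer along the injective `ℤ_p⟦z⟧ → ℚ_p⟦z⟧`) and for their
  reductions `[c]˜ ∈ 𝔽_p⟦z⟧` on the formal group `F̃` of `Ṽ = V ⊗ 𝔽_p`: `[c]˜ ∈ End(F̃)`,
  `F̃([c]˜, [d]˜) = [c + d]˜`, `[c]˜ ∘ [d]˜ = [cd]˜`, `[n]˜ = [n]_Ṽ`, `[−n]˜ = ĩ ∘ [n]_Ṽ`.
* §3 `subst_subst_pair_of_subst_formalGroupLaw` (an endomorphism acts on one-variable sums `F(σ, τ)`),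
  `subst_X_pow_eq_pow_zmod` (`h(zᵖ) = h(z)ᵖ` in `𝔽_p⟦z⟧`).

This is the bookkeeping behind `OrdinaryFormalGroupLubinTate.lean` (the formal group of an ORDINARY curve
over `ℤ_p` is the Lubin–Tate group of `π = p/(unit root of Frobenius)`).  Cell `bsd-print-cf2`, width seat
`bsd-line-cf2c-w4` g12 (measure lane, brick B6 (i) = de Shalit II.1.10).

## References
* [SilvermanAEC2009] J. H. Silverman, *The Arithmetic of Elliptic Curves*, 2nd ed. (2009), IV.2.3 (the maps
  `[m]`), IV.4, IV.5.5 (`log`, `exp` over `R ⊗ ℚ`), IV.6 (the formal group over a complete local ring).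
* [Hazewinkel1978] M. Hazewinkel, *Formal Groups and Applications* (1978), §A.4 (the `ℤ_p`-module `[a](X)`).
-/

noncomputable section

open scoped Classical
open PowerSeries Literature.NumberTheory.EllipticCurves

namespace WeierstrassCurve

/-! ### §1. Over `ℚ_p`: `[c] = exp_W(c log_W)` is an endomorphism; sums and composites -/

section Rat

variable {p : ℕ} [Fact p.Prime] (W : WeierstrassCurve ℚ_[p])

/-- `c·log_W` is substitutable (no constant term). [cite: SilvermanAEC2009, IV.5.5] -/
theorem hasSubst_C_mul_formalLog (c : ℚ_[p]) : HasSubst (C c * W.formalLog) :=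
  HasSubst.of_constantCoeff_zero' (by rw [map_mul, constantCoeff_formalLog, mul_zero])

/-- `[c] = exp_W(c log_W)` is substitutable (no constant term). [cite: SilvermanAEC2009, IV.2.3] -/
theorem hasSubst_formalExp_subst_C_mul_formalLog (c : ℚ_[p]) :
    HasSubst (W.formalExp.subst (C c * W.formalLog)) :=
  HasSubst.of_constantCoeff_zero' (W.constantCoeff_formalExp_subst_C_mul_formalLog c)

/-- `log_W([c](g)) = c · log_W(g)` for a substitutable `g`. [cite: SilvermanAEC2009, IV.5.5] -/
theorem formalLog_subst_formalExp_subst_C_mul_formalLog_subst {τ : Type*} (c : ℚ_[p])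
    {g : MvPowerSeries τ ℚ_[p]} (hg : HasSubst g) :
    W.formalLog.subst (PowerSeries.subst g (W.formalExp.subst (C c * W.formalLog))) =
      MvPowerSeries.C c * W.formalLog.subst g := by
  rw [← subst_comp_subst_apply (W.hasSubst_formalExp_subst_C_mul_formalLog c) hg,
    W.formalLog_subst_formalExp_subst_C_mul_formalLog, subst_mul hg, subst_C]

/-- **`[c] ∈ End(Ŵ)`: `[c](F(z₁, z₂)) = F([c] z₁, [c] z₂)`** — both sides are
`exp_W(c·(log_W z₁ + log_W z₂))`. [cite: SilvermanAEC2009, IV.2.3, IV.5.5] -/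
theorem formalExp_subst_C_mul_formalLog_subst_formalGroupLaw (c : ℚ_[p]) :
    PowerSeries.subst W.formalGroupLaw (W.formalExp.subst (C c * W.formalLog)) =
      MvPowerSeries.subst ![PowerSeries.subst (MvPowerSeries.X 0 : MvPowerSeries (Fin 2) ℚ_[p])
          (W.formalExp.subst (C c * W.formalLog)),
        PowerSeries.subst (MvPowerSeries.X 1 : MvPowerSeries (Fin 2) ℚ_[p])
          (W.formalExp.subst (C c * W.formalLog))] W.formalGroupLaw := by
  have hF := W.hasSubst_formalGroupLaw
  have h0 : ∀ i : Fin 2, MvPowerSeries.constantCoeff (PowerSeries.subst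
      (MvPowerSeries.X i : MvPowerSeries (Fin 2) ℚ_[p]) (W.formalExp.subst (C c * W.formalLog))) = 0 :=
    fun i => constantCoeff_subst_eq_zero (MvPowerSeries.constantCoeff_X i) _
      (W.constantCoeff_formalExp_subst_C_mul_formalLog c)
  rw [W.subst_pair_formalGroupLaw_eq (h0 0) (h0 1),
    W.formalLog_subst_formalExp_subst_C_mul_formalLog_subst c (HasSubst.X 0),
    W.formalLog_subst_formalExp_subst_C_mul_formalLog_subst c (HasSubst.X 1),
    subst_comp_subst_apply (W.hasSubst_C_mul_formalLog c) hF, subst_mul hF, subst_C,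
    W.formalLog_subst_formalGroupLaw, mul_add]

/-- **`F([c], [d]) = [c + d]`** (`= exp_W((c + d)·log_W)`). [cite: SilvermanAEC2009, IV.2.3, IV.5.5] -/
theorem formalGroupLaw_subst_pair_formalExp_subst_C_mul_formalLog (c d : ℚ_[p]) :
    MvPowerSeries.subst ![W.formalExp.subst (C c * W.formalLog), W.formalExp.subst (C d * W.formalLog)]
        W.formalGroupLaw = W.formalExp.subst (C (c + d) * W.formalLog) := by
  rw [W.subst_pair_formalGroupLaw_eq (W.constantCoeff_formalExp_subst_C_mul_formalLog c)
      (W.constantCoeff_formalExp_subst_C_mul_formalLog d),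
    W.formalLog_subst_formalExp_subst_C_mul_formalLog, W.formalLog_subst_formalExp_subst_C_mul_formalLog,
    map_add, add_mul]

/-- **`[c] ∘ [d] = [cd]`** (`[c]([d] z) = exp_W(c·log_W([d] z)) = exp_W(cd·log_W z)`).
[cite: SilvermanAEC2009, IV.2.3, IV.5.5] -/
theorem formalExp_subst_C_mul_formalLog_subst_formalExp_subst_C_mul_formalLog (c d : ℚ_[p]) :
    PowerSeries.subst (W.formalExp.subst (C d * W.formalLog)) (W.formalExp.subst (C c * W.formalLog)) =
      W.formalExp.subst (C (c * d) * W.formalLog) := by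
  have hd := W.hasSubst_formalExp_subst_C_mul_formalLog d
  rw [subst_comp_subst_apply (W.hasSubst_C_mul_formalLog c) hd, subst_mul hd, subst_C,
    W.formalLog_subst_formalExp_subst_C_mul_formalLog, map_mul, mul_assoc]
  rfl

/-- `[1] = z`. [cite: SilvermanAEC2009, IV.5.5] -/
theorem formalExp_subst_C_one_mul_formalLog : W.formalExp.subst (C (1 : ℚ_[p]) * W.formalLog) = X := by
  rw [map_one, one_mul, formalExp_subst_formalLog]

/-- `exp_W = z + O(z²)`. [cite: SilvermanAEC2009, IV.5.5] -/
theorem coeff_one_formalExp : coeff 1 W.formalExp = 1 := by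
  have h := congrArg (coeff 1) W.formalExp_subst_formalLog
  rwa [coeff_one_subst_eq_mul _ W.constantCoeff_formalLog, coeff_one_formalLog, mul_one, coeff_one_X] at h

/-- `[c] = c z + O(z²)`. [cite: SilvermanAEC2009, IV.2.3] -/
theorem coeff_one_formalExp_subst_C_mul_formalLog (c : ℚ_[p]) :
    coeff 1 (W.formalExp.subst (C c * W.formalLog)) = c := by
  have h := congrArg (coeff 1) (W.formalLog_subst_formalExp_subst_C_mul_formalLog c)
  rwa [coeff_one_subst_eq_mul _ (W.constantCoeff_formalExp_subst_C_mul_formalLog c), coeff_one_formalLog,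
    one_mul, coeff_C_mul, coeff_one_formalLog, mul_one] at h

variable [W.IsIntegral ℤ_[p]]

/-- `[n] = formalMul n` for `n ∈ ℕ` (`exp_W(n·log_W)` is the formal multiplication by `n`).
[cite: SilvermanAEC2009, IV.2.3] -/
theorem formalExp_subst_natCast_mul_formalLog (n : ℕ) :
    W.formalExp.subst (C (n : ℚ_[p]) * W.formalLog) = W.formalMul n := by
  rw [map_natCast, ← nsmul_eq_mul, W.formalExp_subst_nsmul_formalLog n]

/-- `i ∘ [n] = [−n]`: `log_W(i([n] z)) = −n·log_W z`, then apply `exp_W`. [cite: SilvermanAEC2009, IV.2.3, IV.5.5] -/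
theorem formalNeg_subst_formalMul_eq (n : ℕ) :
    W.formalNeg.subst (W.formalMul n) = W.formalExp.subst (C (-(n : ℚ_[p])) * W.formalLog) := by
  have hn := W.hasSubst_formalMul n
  have hlog : W.formalLog.subst (W.formalNeg.subst (W.formalMul n)) = C (-(n : ℚ_[p])) * W.formalLog := by
    rw [← subst_comp_subst_apply W.hasSubst_formalNeg hn, W.formalLog_subst_formalNeg,
      ← coe_substAlgHom hn, map_neg, coe_substAlgHom hn, W.formalLog_subst_formalMul, map_neg, map_natCast,
      neg_mul, nsmul_eq_mul]
  have h0 : constantCoeff (W.formalNeg.subst (W.formalMul n)) = 0 :=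
    constantCoeff_subst_eq_zero (W.constantCoeff_formalMul n) _ W.constantCoeff_formalNeg
  have h := congrArg (fun g => W.formalExp.subst g) hlog
  rwa [← subst_comp_subst_apply (hasSubst_formalLog W) (HasSubst.of_constantCoeff_zero' h0),
    formalExp_subst_formalLog, subst_X (HasSubst.of_constantCoeff_zero' h0)] at h

omit [W.IsIntegral ℤ_[p]] in
/-- **`F(zᵖ, i([c] z)) = −c·z + O(z²)`** for `p ≥ 2`: the series is `exp_W(log_W(zᵖ) − c·log_W z)` and
`log_W(zᵖ) = O(z²)`. [cite: SilvermanAEC2009, IV.2.3, IV.5.5] -/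
theorem coeff_one_formalGroupLaw_subst_X_pow_formalNeg (c : ℚ_[p]) :
    coeff 1 (MvPowerSeries.subst ![(X : ℚ_[p]⟦X⟧) ^ p,
      W.formalNeg.subst (W.formalExp.subst (C c * W.formalLog))] W.formalGroupLaw) = -c := by
  have hp : p ≠ 0 := (Fact.out : p.Prime).ne_zero
  have hXp : constantCoeff ((X : ℚ_[p]⟦X⟧) ^ p) = 0 := by rw [map_pow, constantCoeff_X, zero_pow hp]
  have hc := W.hasSubst_formalExp_subst_C_mul_formalLog c
  have hi0 : constantCoeff (W.formalNeg.subst (W.formalExp.subst (C c * W.formalLog))) = 0 :=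
    constantCoeff_subst_eq_zero (W.constantCoeff_formalExp_subst_C_mul_formalLog c) _ W.constantCoeff_formalNeg
  have hlogi : W.formalLog.subst (W.formalNeg.subst (W.formalExp.subst (C c * W.formalLog))) =
      -(C c * W.formalLog) := by
    rw [← subst_comp_subst_apply W.hasSubst_formalNeg hc, W.formalLog_subst_formalNeg, ← coe_substAlgHom hc,
      map_neg, coe_substAlgHom hc, W.formalLog_subst_formalExp_subst_C_mul_formalLog]
  have hin0 : constantCoeff (W.formalLog.subst ((X : ℚ_[p]⟦X⟧) ^ p) + -(C c * W.formalLog)) = 0 := by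
    rw [map_add, map_neg, Literature.RingTheory.FormalGroups.constantCoeff_subst_of_constantCoeff_eq_zero hXp,
      constantCoeff_formalLog, map_mul, constantCoeff_formalLog, mul_zero, neg_zero, add_zero]
  rw [W.subst_pair_formalGroupLaw_eq hXp hi0, hlogi, coeff_one_subst_eq_mul _ hin0, coeff_one_formalExp,
    one_mul, map_add, map_neg, coeff_C_mul, coeff_one_formalLog, mul_one, coeff_subst_X_pow hp, if_neg, zero_add]
  intro h1
  exact (Fact.out : p.Prime).one_lt.ne' (Nat.eq_one_of_dvd_one h1)

end Rat

/-! ### §2. Over `ℤ_p` and its quotients: the integral series `[c]_ℤ` (`[c]_ℤ ↦ [c]` under `ℤ_p⟦z⟧ ↪ ℚ_p⟦z⟧`) -/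

section Integral

variable {p : ℕ} [Fact p.Prime] (V : WeierstrassCurve ℤ_[p])

/-- `ℤ_p⟦σ⟧ → ℚ_p⟦σ⟧` is injective. [folklore] -/
private theorem mvPowerSeries_map_coe_injective {σ : Type*} :
    Function.Injective (MvPowerSeries.map (σ := σ) (PadicInt.Coe.ringHom (p := p))) :=
  mvPowerSeries_map_injective (fun _ _ h => PadicInt.ext h)

/-- `ℤ_p⟦z⟧ → ℚ_p⟦z⟧` is injective. [folklore] -/
private theorem powerSeries_map_coe_injective :
    Function.Injective (PowerSeries.map (PadicInt.Coe.ringHom (p := p))) :=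
  fun _ _ h => mvPowerSeries_map_coe_injective h

/-- **Existence of the integral series `[c]_ℤ`**: for `c ∈ ℤ_p` there is `P ∈ ℤ_p⟦z⟧` mapping to
`[c] = exp_W(c log_W)` of `W = V ⊗ ℚ_p` (`isPadicInt_formalExp_subst_C_mul_formalLog`).
[cite: SilvermanAEC2009, IV.2.3, IV.6] -/
theorem exists_map_eq_formalExp_subst_C_mul_formalLog (c : ℤ_[p]) :
    ∃ P : ℤ_[p]⟦X⟧, P.map PadicInt.Coe.ringHom =
      (V.map PadicInt.Coe.ringHom).formalExp.subst (C (c : ℚ_[p]) * (V.map PadicInt.Coe.ringHom).formalLog) := by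
  haveI := V.isIntegral_map_coe
  exact isPadicInt_iff_exists_powerSeries_map.mp
    ((V.map PadicInt.Coe.ringHom).isPadicInt_formalExp_subst_C_mul_formalLog (a := (c : ℚ_[p])) c.2)

variable {V}
variable {c d : ℤ_[p]} {P Q : ℤ_[p]⟦X⟧}
  (hP : P.map PadicInt.Coe.ringHom =
    (V.map PadicInt.Coe.ringHom).formalExp.subst (C (c : ℚ_[p]) * (V.map PadicInt.Coe.ringHom).formalLog))
  (hQ : Q.map PadicInt.Coe.ringHom =
    (V.map PadicInt.Coe.ringHom).formalExp.subst (C (d : ℚ_[p]) * (V.map PadicInt.Coe.ringHom).formalLog))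

include hP in
/-- `[c]_ℤ(0) = 0`. [cite: SilvermanAEC2009, IV.2.3] -/
theorem constantCoeff_eq_zero_of_map_eq : constantCoeff P = 0 := by
  apply PadicInt.ext
  have h := congrArg (coeff 0) hP
  rw [coeff_map, coeff_zero_eq_constantCoeff_apply, coeff_zero_eq_constantCoeff_apply,
    (V.map PadicInt.Coe.ringHom).constantCoeff_formalExp_subst_C_mul_formalLog] at h
  exact h

include hP in
/-- `[c]_ℤ = c z + O(z²)`. [cite: SilvermanAEC2009, IV.2.3] -/
theorem coeff_one_eq_of_map_eq : coeff 1 P = c := by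
  apply PadicInt.ext
  have h := congrArg (coeff 1) hP
  rw [coeff_map, (V.map PadicInt.Coe.ringHom).coeff_one_formalExp_subst_C_mul_formalLog] at h
  exact h

include hP in
/-- **`[c]_ℤ ∈ End(V̂)` over `ℤ_p`**: `[c]_ℤ(F(z₁,z₂)) = F([c]_ℤ z₁, [c]_ℤ z₂)` in `ℤ_p⟦z₁, z₂⟧`.
[cite: SilvermanAEC2009, IV.2.3, IV.6] -/
theorem subst_formalGroupLaw_of_map_eq :
    PowerSeries.subst V.formalGroupLaw P =
      MvPowerSeries.subst ![PowerSeries.subst (MvPowerSeries.X 0 : MvPowerSeries (Fin 2) ℤ_[p]) P,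
        PowerSeries.subst (MvPowerSeries.X 1 : MvPowerSeries (Fin 2) ℤ_[p]) P] V.formalGroupLaw := by
  have hP0 := constantCoeff_eq_zero_of_map_eq hP
  have h0 : ∀ i : Fin 2, MvPowerSeries.constantCoeff
      (PowerSeries.subst (MvPowerSeries.X i : MvPowerSeries (Fin 2) ℤ_[p]) P) = 0 :=
    fun i => constantCoeff_subst_eq_zero (MvPowerSeries.constantCoeff_X i) _ hP0
  apply mvPowerSeries_map_coe_injective
  rw [PowerSeries.map_subst V.hasSubst_formalGroupLaw, map_formalGroupLaw, hP,
    map_subst_pair_formalGroupLaw V _ (h0 0) (h0 1), PowerSeries.map_subst (HasSubst.X 0),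
    PowerSeries.map_subst (HasSubst.X 1), MvPowerSeries.map_X, MvPowerSeries.map_X, hP]
  exact (V.map PadicInt.Coe.ringHom).formalExp_subst_C_mul_formalLog_subst_formalGroupLaw (c : ℚ_[p])

include hP in
/-- The endomorphism property after ANY base change `φ : ℤ_p → S` (e.g. reduction modulo `p`):
`[c]˜(F̃(z₁,z₂)) = F̃([c]˜ z₁, [c]˜ z₂)`. [cite: SilvermanAEC2009, IV.2.3, IV.6] -/
theorem map_subst_formalGroupLaw_of_map_eq {S : Type*} [CommRing S] (φ : ℤ_[p] →+* S) :
    PowerSeries.subst (V.map φ).formalGroupLaw (P.map φ) =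
      MvPowerSeries.subst ![PowerSeries.subst (MvPowerSeries.X 0 : MvPowerSeries (Fin 2) S) (P.map φ),
        PowerSeries.subst (MvPowerSeries.X 1 : MvPowerSeries (Fin 2) S) (P.map φ)] (V.map φ).formalGroupLaw := by
  have hP0 := constantCoeff_eq_zero_of_map_eq hP
  have h0 : ∀ i : Fin 2, MvPowerSeries.constantCoeff
      (PowerSeries.subst (MvPowerSeries.X i : MvPowerSeries (Fin 2) ℤ_[p]) P) = 0 :=
    fun i => constantCoeff_subst_eq_zero (MvPowerSeries.constantCoeff_X i) _ hP0
  have h := congrArg (MvPowerSeries.map φ) (subst_formalGroupLaw_of_map_eq hP)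
  rwa [PowerSeries.map_subst V.hasSubst_formalGroupLaw, map_formalGroupLaw,
    map_subst_pair_formalGroupLaw V _ (h0 0) (h0 1), PowerSeries.map_subst (HasSubst.X 0),
    PowerSeries.map_subst (HasSubst.X 1), MvPowerSeries.map_X, MvPowerSeries.map_X] at h

include hP hQ in
/-- **`F([c]_ℤ, [d]_ℤ) = [c + d]_ℤ`** over `ℤ_p`, for any integral lift `S` of `[c + d]`.
[cite: SilvermanAEC2009, IV.2.3] -/
theorem subst_pair_formalGroupLaw_of_map_eq {S : ℤ_[p]⟦X⟧} (hS : S.map PadicInt.Coe.ringHom =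
      (V.map PadicInt.Coe.ringHom).formalExp.subst (C ((c + d : ℤ_[p]) : ℚ_[p]) *
        (V.map PadicInt.Coe.ringHom).formalLog)) :
    MvPowerSeries.subst ![P, Q] V.formalGroupLaw = S := by
  apply powerSeries_map_coe_injective
  have h := map_subst_pair_formalGroupLaw V PadicInt.Coe.ringHom (σ := Unit)
    (constantCoeff_eq_zero_of_map_eq hP) (constantCoeff_eq_zero_of_map_eq hQ)
  refine h.trans ?_
  change MvPowerSeries.subst ![P.map PadicInt.Coe.ringHom, Q.map PadicInt.Coe.ringHom] _ = _
  rw [hP, hQ, hS, PadicInt.coe_add]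
  exact (V.map PadicInt.Coe.ringHom).formalGroupLaw_subst_pair_formalExp_subst_C_mul_formalLog _ _

include hP hQ in
/-- **`[c]_ℤ ∘ [d]_ℤ = [cd]_ℤ`** over `ℤ_p`. [cite: SilvermanAEC2009, IV.2.3] -/
theorem subst_of_map_eq {T : ℤ_[p]⟦X⟧} (hT : T.map PadicInt.Coe.ringHom =
      (V.map PadicInt.Coe.ringHom).formalExp.subst (C ((c * d : ℤ_[p]) : ℚ_[p]) *
        (V.map PadicInt.Coe.ringHom).formalLog)) :
    PowerSeries.subst Q P = T := by
  apply powerSeries_map_coe_injective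
  rw [Literature.NumberTheory.EllipticCurves.powerSeries_map_subst (HasSubst.of_constantCoeff_zero' (constantCoeff_eq_zero_of_map_eq hQ)),
    hP, hQ, hT, PadicInt.coe_mul]
  exact (V.map PadicInt.Coe.ringHom).formalExp_subst_C_mul_formalLog_subst_formalExp_subst_C_mul_formalLog _ _

/-- **`[n]_ℤ = formalMul n`** (`n ∈ ℕ`): the integral lift of `[n]` IS the formal multiplication by `n`
of `V`. [cite: SilvermanAEC2009, IV.2.3] -/
theorem eq_formalMul_of_map_eq {n : ℕ} {P : ℤ_[p]⟦X⟧} (hP : P.map PadicInt.Coe.ringHom =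
      (V.map PadicInt.Coe.ringHom).formalExp.subst (C ((n : ℤ_[p]) : ℚ_[p]) *
        (V.map PadicInt.Coe.ringHom).formalLog)) :
    P = V.formalMul n := by
  haveI := V.isIntegral_map_coe
  apply powerSeries_map_coe_injective
  rw [hP, map_formalMul, PadicInt.coe_natCast]
  exact (V.map PadicInt.Coe.ringHom).formalExp_subst_natCast_mul_formalLog n

/-- **`[−n]_ℤ = i ∘ formalMul n`** (`n ∈ ℕ`). [cite: SilvermanAEC2009, IV.2.3] -/
theorem eq_formalNeg_subst_formalMul_of_map_eq {n : ℕ} {P : ℤ_[p]⟦X⟧} (hP : P.map PadicInt.Coe.ringHom =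
      (V.map PadicInt.Coe.ringHom).formalExp.subst (C ((-(n : ℤ_[p]) : ℤ_[p]) : ℚ_[p]) *
        (V.map PadicInt.Coe.ringHom).formalLog)) :
    P = V.formalNeg.subst (V.formalMul n) := by
  haveI := V.isIntegral_map_coe
  apply powerSeries_map_coe_injective
  rw [hP, Literature.NumberTheory.EllipticCurves.powerSeries_map_subst (V.hasSubst_formalMul n), map_formalNeg, map_formalMul, PadicInt.coe_neg,
    PadicInt.coe_natCast]
  exact ((V.map PadicInt.Coe.ringHom).formalNeg_subst_formalMul_eq n).symm

include hQ in
/-- **`F(zᵖ, i([d]_ℤ z)) = −d·z + O(z²)`** over `ℤ_p`. [cite: SilvermanAEC2009, IV.2.3] -/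
theorem coeff_one_subst_X_pow_formalNeg_of_map_eq :
    coeff 1 (MvPowerSeries.subst ![(X : ℤ_[p]⟦X⟧) ^ p, V.formalNeg.subst Q] V.formalGroupLaw) = -d := by
  have hp : p ≠ 0 := (Fact.out : p.Prime).ne_zero
  have hQ0 := constantCoeff_eq_zero_of_map_eq hQ
  have hXp : constantCoeff ((X : ℤ_[p]⟦X⟧) ^ p) = 0 := by rw [map_pow, constantCoeff_X, zero_pow hp]
  have hi0 : constantCoeff (V.formalNeg.subst Q) = 0 := by
    rw [Literature.RingTheory.FormalGroups.constantCoeff_subst_of_constantCoeff_eq_zero hQ0, constantCoeff_formalNeg]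
  apply PadicInt.ext
  have h := map_subst_pair_formalGroupLaw V PadicInt.Coe.ringHom (σ := Unit) hXp hi0
  have h1 := congrArg (coeff 1) h
  change PadicInt.Coe.ringHom (coeff 1 _) = coeff 1 (MvPowerSeries.subst
    ![PowerSeries.map PadicInt.Coe.ringHom (X ^ p), PowerSeries.map PadicInt.Coe.ringHom (V.formalNeg.subst Q)] _) at h1
  rw [map_pow, map_X, Literature.NumberTheory.EllipticCurves.powerSeries_map_subst (HasSubst.of_constantCoeff_zero' hQ0), map_formalNeg, hQ,
    (V.map PadicInt.Coe.ringHom).coeff_one_formalGroupLaw_subst_X_pow_formalNeg] at h1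
  rw [PadicInt.coe_neg]
  exact h1

end Integral

/-! ### §3. Two generic lemmas: endomorphisms act on one-variable sums; Frobenius `h(zᵖ) = h(z)ᵖ` over `𝔽_p` -/

section Generic

variable {p : ℕ} [hp : Fact p.Prime] (V : WeierstrassCurve ℤ_[p])

/-- An endomorphism `P` of a formal group law `F` (`P(F) = F(P z₁, P z₂)`) acts on one-variable sums:
`P(F(σ, τ)) = F(P(σ), P(τ))`. [cite: SilvermanAEC2009, IV.2.3] -/
theorem subst_subst_pair_of_subst_formalGroupLaw {S : Type*} [CommRing S] (φ : ℤ_[p] →+* S) {P : S⟦X⟧}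
    (hP0 : constantCoeff P = 0)
    (hend : PowerSeries.subst (V.map φ).formalGroupLaw P =
      MvPowerSeries.subst ![PowerSeries.subst (MvPowerSeries.X 0 : MvPowerSeries (Fin 2) S) P,
        PowerSeries.subst (MvPowerSeries.X 1 : MvPowerSeries (Fin 2) S) P] (V.map φ).formalGroupLaw)
    {σ τ : S⟦X⟧} (hσ : constantCoeff σ = 0) (hτ : constantCoeff τ = 0) :
    PowerSeries.subst (MvPowerSeries.subst ![σ, τ] (V.map φ).formalGroupLaw) P =
      MvPowerSeries.subst ![PowerSeries.subst σ P, PowerSeries.subst τ P] (V.map φ).formalGroupLaw := by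
  have hs := hasSubst_pair hσ hτ
  have h := congrArg (MvPowerSeries.subst ![σ, τ]) hend
  rw [mvSubst_powerSeries_subst (V.map φ).hasSubst_formalGroupLaw hs,
    MvPowerSeries.subst_comp_subst_apply
      (hasSubst_pair (constantCoeff_subst_eq_zero (MvPowerSeries.constantCoeff_X 0) _ hP0)
        (constantCoeff_subst_eq_zero (MvPowerSeries.constantCoeff_X 1) _ hP0)) hs] at h
  rw [h]
  congr 1
  funext i
  fin_cases i
  · change MvPowerSeries.subst ![σ, τ] (PowerSeries.subst (MvPowerSeries.X 0) P) = _
    rw [mvSubst_powerSeries_subst (HasSubst.X 0) hs, MvPowerSeries.subst_X hs]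
    rfl
  · change MvPowerSeries.subst ![σ, τ] (PowerSeries.subst (MvPowerSeries.X 1) P) = _
    rw [mvSubst_powerSeries_subst (HasSubst.X 1) hs, MvPowerSeries.subst_X hs]
    rfl

/-- Over `𝔽_p`, `h(zᵖ) = h(z)ᵖ` (`h^p = h^{(p)}(z^p)` and Frobenius fixes `𝔽_p`). [cite: SilvermanAEC2009, IV.2, A.1.2] -/
theorem subst_X_pow_eq_pow_zmod (h : (ZMod p)⟦X⟧) :
    PowerSeries.subst ((X : (ZMod p)⟦X⟧) ^ p) h = h ^ p := by
  have hp0 : p ≠ 0 := hp.out.ne_zero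
  have h1 := MvPowerSeries.map_frobenius_expand p hp0 (f := (h : MvPowerSeries Unit (ZMod p)))
  rw [ZMod.frobenius_zmod, MvPowerSeries.map_id] at h1
  rw [← h1]
  exact (PowerSeries.expand_apply p hp0 h).symm

end Generic

end WeierstrassCurve
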